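import Literature.AlgebraicGeometry.Frobenioids.ModelFrobenioidUntr
import Literature.AlgebraicGeometry.Frobenioids.Prop55Sub
import HarnessLib

/-!
# [FrdI] Proposition 5.5 (iv), sub-DAG row P55-L08 (`C^un-tr` of the model Frobenioid) — discharge

Mochizuki, *The geometry of Frobenioids I: the general theory*, Kyushu J. Math. **62** (2008)
293–400, §5, Proposition 5.5 (iv), kurims p. 104 ll. 40–44 [cite: MochizukiFrdI2008, Prop. 5.5 (iv) p.104].
PROOF-ONLY companion of `Prop55Sub.lean` (statements, seat abc-iut-w4-d084; slot map STATUS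
2026-08-25T23:43:22Z): the named row `FrdI.Prop55Sub.Prop55iv_untr` — "a natural equivalence of
categories between `C^un-tr` [of the model Frobenioid `C` of `(Φ, B, Div_B)`] and the model Frobenioid
associated to the data `Φ, Φ^birat, Φ^birat ↪ Φ^gp`", compatible with the structure functors to
`F_Φ` — holds, by `ModelFrobenioid.nonempty_untr_equivalence_modelOf` (`ModelFrobenioidUntr.lean`, seat
abc-iut-L1-t2) at the subfunctor of groups `GpSubfunctor.ofModelData Φ B Div_B` (whose value at `A` is
the image of `Div_B` by definition).  The printed antecedent "Frobenius-isotropic and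
Frobenius-normalized type" of Prop. 5.5 is not used.  No new definitions.
-/

namespace Literature.AlgebraicGeometry.Frobenioids

open CategoryTheory Opposite

namespace FrdI.Prop55Sub

universe w v u

variable {D : Type u} [Category.{v} D] (Φ B : Dᵒᵖ ⥤ CommMonCat.{w}) (DivB : B ⟶ monoidGp Φ)

/-- **Row P55-L08 `Prop55iv_untr` DISCHARGED** ([FrdI] Prop. 5.5 (iv) p. 104, `C^un-tr` of the model
Frobenioid): `ModelFrobenioidUntr.lean` (seat abc-iut-L1-t2). [cite: MochizukiFrdI2008, Prop. 5.5 (iv) p.104] -/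
theorem Prop55iv_untr_holds :
    ∀ h : ModelFrobenioid.Hypotheses Φ B, Prop55iv_untr Φ B DivB h :=
  fun h _ _ => ModelFrobenioid.nonempty_untr_equivalence_modelOf _ (h.isFrobenioid Φ B DivB)
    (fun _ _ => Iff.rfl) h.isGroupLike_rat

end FrdI.Prop55Sub

end Literature.AlgebraicGeometry.Frobenioids
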